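import Literature.AlgebraicTopology.CharacteristicClasses.LineThomClassGluing
import HarnessLib

/-!
# Low-degree cohomology of `P(λ ⊕ ℂ)|_S` over trivialisable `S` and over disjoint unions

Companion of `LineThomClassLocal` / `LineThomClassGluing` (Milnor–Stasheff §10, proof of
Thm. 10.4; Husemoller Ch. 17 §2): over a set `S` inside the base set of an atlas trivialisation,
`P(λ ⊕ ℂ)|_S ≅ S × ℂP¹`, so (`SphereLikeProductCohomology.map_fst_bijective_zero/one`)

* `eq_map_complProjOn_of_subset_baseSet` — **every class of degree `k ≤ 1` on `P(λ ⊕ ℂ)|_S` is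
  pulled back from `S`**, namely from its restriction along the section at infinity
  (`IsPulledBack S k`), and consequently a degree-`≤ 1` class killed by the section at infinity
  vanishes (`IsInfDetected S k`);
* the degree-two analogue `IsFibreDetected S` (a class killed by the section at infinity and by all
  fibres vanishes) holds over such `S` (`LineThomClassLocal.eq_zero_of_map_complInfOn_eq_zero`);
* all three properties pass to DISJOINT OPEN UNIONS (`isPulledBack_iUnion`,
  `isInfDetected_iUnion`, `isFibreDetected_iUnion`; additivity `CohomologyDisjointOpenCover`).

These are the inputs of the Mayer–Vietoris / pair-sequence induction proving the uniqueness of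
the Thom class over finite unions (sequel). Everything is proved; no named facts.

## References

* J. Milnor, J. Stasheff, *Characteristic Classes*, PUP 1974, §10 pp. 111–113. [MilnorStasheff1974]
* D. Husemoller, *Fibre Bundles*, GTM 20, Springer 1994, Ch. 17 §2. [HusemollerFibreBundles1994]
-/

noncomputable section

open CategoryTheory Function Set Bundle Literature.AlgebraicTopology.SingularHomology
open scoped LinearAlgebra.Projectivization

universe u

namespace Literature.AlgebraicTopology.CharacteristicClasses

variable {B : Type u} [TopologicalSpace B] (F : Type u) [NormedAddCommGroup F] [NormedSpace ℂ F] [FiniteDimensional ℂ F]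
  (E : B → Type u) [∀ b, AddCommGroup (E b)] [∀ b, Module ℂ (E b)]
  [TopologicalSpace (TotalSpace F E)] [∀ b, TopologicalSpace (E b)] [FiberBundle F E] [VectorBundle ℂ F E]
  (hF : Module.finrank ℂ F = 1) (R : Type u) [CommRing R]

/-! ### The three detection properties -/

/-- **`IsPulledBack S k`**: every class of `Hᵏ(P(λ ⊕ ℂ)|_S; R)` is `π^*` of its restriction along the
section at infinity. [folklore] -/
def IsPulledBack (S : Set B) (k : ℕ) : Prop :=
  ∀ z : singularCohomology R R ↥(complPreimage F E S) k,
    z = singularCohomology.map R R (complProjOn F E S) k (singularCohomology.map R R (complInfOn F E hF S) k z)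

/-- **`IsInfDetected S k`**: a class of `Hᵏ(P(λ ⊕ ℂ)|_S; R)` killed by the section at infinity vanishes. [folklore] -/
def IsInfDetected (S : Set B) (k : ℕ) : Prop :=
  ∀ z : singularCohomology R R ↥(complPreimage F E S) k,
    singularCohomology.map R R (complInfOn F E hF S) k z = 0 → z = 0

/-- **`IsFibreDetected S`**: a class of `H²(P(λ ⊕ ℂ)|_S; R)` killed by the section at infinity and by
all fibres vanishes. [folklore] -/
def IsFibreDetected (S : Set B) : Prop :=
  ∀ x : singularCohomology R R ↥(complPreimage F E S) 2,
    singularCohomology.map R R (complInfOn F E hF S) 2 x = 0 →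
      (∀ (b : B) (hb : b ∈ S), singularCohomology.map R R (complFibOn hb) 2 x = 0) → x = 0

variable {F E}

/-- Pulled back implies detected by the section at infinity. [folklore] -/
theorem IsPulledBack.isInfDetected {S : Set B} {k : ℕ} (h : IsPulledBack F E hF R S k) : IsInfDetected F E hF R S k :=
  fun z hz ↦ by rw [h z, hz, map_zero]

/-- Detected by the section at infinity implies pulled back (`z − π^* s^* z` is killed by `s^*`). [folklore] -/
theorem IsInfDetected.isPulledBack {S : Set B} {k : ℕ} (h : IsInfDetected F E hF R S k) : IsPulledBack F E hF R S k := by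
  intro z
  rw [← sub_eq_zero]
  refine h _ ?_
  rw [map_sub, ← ModuleCat.comp_apply (singularCohomology.map R R (complProjOn F E S) k), ← singularCohomology.map_comp,
    complProjOn_comp_complInfOn, singularCohomology.map_id, ModuleCat.id_apply, sub_self]

/-- Fibre detection implies uniqueness of normalised classes. [folklore] -/
theorem IsFibreDetected.isUniq {S : Set B} (h : IsFibreDetected F E hF R S) : IsUniq F E hF R S := fun _ x x' hx hx' ↦ by
  obtain ⟨h1, h2⟩ := hx.sub hF hx'
  exact sub_eq_zero.1 (h (x - x') h1 h2)

/-! ### Over trivialisable sets -/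

variable (e : Trivialization F (π F E)) [MemTrivializationAtlas e]

/-- `pr₁ ∘ h_e = π` for the local product structure. [folklore] -/
theorem fst_comp_complLocalHomeomorph {S : Set B} (hS : S ⊆ e.baseSet) :
    (ContinuousMap.fst : C(↥S × ℙ ℂ (F × ℂ), ↥S)).comp
      (complLocalHomeomorph e hS : C(↥(complPreimage F E S), ↥S × ℙ ℂ (F × ℂ))) = complProjOn F E S := by
  ext1 p
  exact Subtype.ext (complLocalHomeomorph_fst e hS p)

/-- **Over trivialisable `S`, classes of degree `≤ 1` are pulled back from `S`** (`P(λ ⊕ ℂ)|_S ≅ S × ℂP¹`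
and `pr₁^* : Hᵏ(S) ≅ Hᵏ(S × ℂP¹)` for `k ≤ 1`). [cite: MilnorStasheff1974, §10 pp. 111–113] -/
theorem isPulledBack_of_subset_baseSet {S : Set B} (hS : S ⊆ e.baseSet) {k : ℕ} (hk : k ≤ 1) :
    IsPulledBack F E hF R S k := by
  intro z
  set h := complLocalHomeomorph e hS with hh
  set y := singularCohomology.map R R (h.symm : C(↥S × ℙ ℂ (F × ℂ), ↥(complPreimage F E S))) k z with hy
  -- `y` is pulled back from `↥S`
  obtain ⟨w, hw⟩ : ∃ w : singularCohomology R R ↥S k,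
      singularCohomology.map R R (ContinuousMap.fst : C(↥S × ℙ ℂ (F × ℂ), ↥S)) k w = y := by
    interval_cases k
    · exact ((modelSphereLike F hF).map_fst_bijective_zero R R (U := ↥S)).2 y
    · exact ((modelSphereLike F hF).map_fst_bijective_one R R (U := ↥S)).2 y
  have hz : z = singularCohomology.map R R (complProjOn F E S) k w := by
    rw [← fst_comp_complLocalHomeomorph e hS, singularCohomology.map_comp, ModuleCat.comp_apply, hw, hy,
      ← ModuleCat.comp_apply, ← singularCohomology.map_comp, ← hh, Homeomorph.symm_comp_toContinuousMap,
      singularCohomology.map_id]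
    rfl
  have hw' : singularCohomology.map R R (complInfOn F E hF S) k z = w := by
    rw [hz, ← ModuleCat.comp_apply, ← singularCohomology.map_comp, complProjOn_comp_complInfOn,
      singularCohomology.map_id]
    rfl
  rw [hw', ← hz]

/-- Over trivialisable `S`, degree-`≤ 1` classes killed by the section at infinity vanish. [cite: MilnorStasheff1974, §10 pp. 111–113] -/
theorem isInfDetected_of_subset_baseSet {S : Set B} (hS : S ⊆ e.baseSet) {k : ℕ} (hk : k ≤ 1) :
    IsInfDetected F E hF R S k :=
  (isPulledBack_of_subset_baseSet hF R e hS hk).isInfDetected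

/-- Over trivialisable `S`, fibre detection holds (`LineThomClassLocal`). [cite: MilnorStasheff1974, §10 Thm. 10.4] -/
theorem isFibreDetected_of_subset_baseSet {S : Set B} (hS : S ⊆ e.baseSet) : IsFibreDetected F E hF R S :=
  fun x h1 h2 ↦ eq_zero_of_map_complInfOn_eq_zero hF e hS x h1 h2

/-! ### Over disjoint open unions -/

variable {J : Type*} {S : J → Set B} (hSo : ∀ j, IsOpen (S j)) (hdisj : Pairwise (Disjoint on S))
include hSo hdisj

omit e in
/-- **Detection by the section at infinity passes to disjoint open unions.** [cite: HatcherAT2002, §3.1 p. 202] -/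
theorem isInfDetected_iUnion {k : ℕ} (h : ∀ j, IsInfDetected F E hF R (S j) k) : IsInfDetected F E hF R (⋃ j, S j) k := by
  intro z hz
  refine eq_zero_of_forall_map_piece_eq_zero R R (isClopenPartition_complPiece F E hSo hdisj)
    (fun j ↦ complPieceHomeomorph F E (subset_iUnion S j)) (fun j ↦ complPreimageIncl (subset_iUnion S j))
    (fun j ↦ rfl) fun j ↦ h j _ ?_
  rw [← ModuleCat.comp_apply, ← singularCohomology.map_comp, complPreimageIncl_comp_complInfOn hF,
    singularCohomology.map_comp, ModuleCat.comp_apply, hz, map_zero]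

omit e in
/-- **Pulled-back-ness passes to disjoint open unions.** [cite: HatcherAT2002, §3.1 p. 202] -/
theorem isPulledBack_iUnion {k : ℕ} (h : ∀ j, IsPulledBack F E hF R (S j) k) : IsPulledBack F E hF R (⋃ j, S j) k :=
  (isInfDetected_iUnion hF R hSo hdisj fun j ↦ (h j).isInfDetected).isPulledBack

omit e in
/-- **Fibre detection passes to disjoint open unions.** [cite: HatcherAT2002, §3.1 p. 202] -/
theorem isFibreDetected_iUnion (h : ∀ j, IsFibreDetected F E hF R (S j)) : IsFibreDetected F E hF R (⋃ j, S j) := by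
  intro x h1 h2
  refine eq_zero_of_forall_map_piece_eq_zero R R (isClopenPartition_complPiece F E hSo hdisj)
    (fun j ↦ complPieceHomeomorph F E (subset_iUnion S j)) (fun j ↦ complPreimageIncl (subset_iUnion S j))
    (fun j ↦ rfl) fun j ↦ h j _ ?_ fun b hb ↦ ?_
  · rw [← ModuleCat.comp_apply, ← singularCohomology.map_comp, complPreimageIncl_comp_complInfOn hF,
      singularCohomology.map_comp, ModuleCat.comp_apply, h1, map_zero]
  · rw [← ModuleCat.comp_apply, ← singularCohomology.map_comp, complPreimageIncl_comp_complFibOn,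
      h2 b (subset_iUnion S j hb)]

end Literature.AlgebraicTopology.CharacteristicClasses
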